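import Literature.Algebra.Lie.SpecialLinearAutomorphismsClassification
import Literature.Algebra.Lie.SpecialLinearAutomorphisms
import HarnessLib

/-!
# Automorphisms of `𝔰𝔩ₙ`, VII: the named fact `Jacobson1962_sl_automorphisms` DISCHARGED
# (Jacobson, *Lie Algebras*, Ch. IX §5, Theorem 5)

Topic `Algebra/Lie`. Cell `hodge-nonav`, route `Summits/HodgeConjecture/HodgeConjecture/Theses/CyclicUnitaryPowers.lean`,
crux K1 (stmt-HodgeConjecture-19544), roadmap `HOME/memos/GKR-CORE-ROADMAP-Ax-g2.md` step C5.  The literature-typing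
seat `littype-FH1-2` recorded Jacobson's Theorem 5 as the NAMED FACT
`Literature.Algebra.Lie.SpecialLinearAutomorphisms.Jacobson1962_sl_automorphisms` (file `SpecialLinearAutomorphisms`);
parts I–V of this series (`SpecialLinearAdSemisimple`, `SpecialLinearToralNormalisation`, `SpecialLinearRootTransport`,
`SpecialLinearRootCombinatorics`, `SpecialLinearAutomorphismsClassification`) prove it, and this file states the
discharge `Jacobson1962_sl_automorphisms_holds` in the fact's exact shape: `A` nonsingular with `φ X = A⁻¹XA`, or
`|n| > 2` and `φ X = −A⁻¹XᵀA`.  The only extra input is Jacobson's remark for `|n| = 2` (p. 282): «if `l = 1`, then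
`−X' = A⁻¹XA` for `A = (0 1; −1 0)`», i.e. on traceless `2 × 2` matrices minus-transpose IS a conjugation
(`exists_neg_transpose_eq_conj_of_card_two`, by the four-entry computation), so that for `|n| = 2` the second
alternative of part V folds into the first.  Everything is PROVED (0 `sorry`, no new definition, no named fact).

## References

* [Jacobson1962LieAlgebras] N. Jacobson, *Lie Algebras*, Ch. IX §5, Theorem 5 (p. 283) and p. 282 (the case `l = 1`)
  (held: galaxy panama:489961279193147, chars ≈ 838500–846500).
-/

attribute [local instance 100] LieRing.ofAssociativeRing

namespace Literature.Algebra.Lie.SpecialLinearAutomorphisms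

open LieAlgebra LieAlgebra.SpecialLinear Matrix Module

variable {n : Type*} [Fintype n] [DecidableEq n] {K : Type*} [Field K]

section Holds

/-- For `|n| = 2`: `−Xᵀ = J' X J` for traceless `X`, with `J = E_pq − E_qp`, `J' = E_qp − E_pq`, `J J' = 1`
(Jacobson p. 282: «if l = 1, then −X' = A⁻¹XA for A = (0 1; −1 0)»). [folklore] -/
private theorem exists_neg_transpose_eq_conj_of_card_two (hn : Fintype.card n = 2) :
    ∃ J J' : Matrix n n K, J * J' = 1 ∧ J' * J = 1 ∧
      ∀ X : Matrix n n K, X.trace = 0 → -Xᵀ = J' * X * J := by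
  classical
  obtain ⟨p, q, hpq, huniv⟩ := Finset.card_eq_two.1 (by rw [Finset.card_univ, hn] : (Finset.univ : Finset n).card = 2)
  have hall : ∀ x : n, x = p ∨ x = q := fun x => by
    have hx := Finset.mem_univ x
    rw [huniv, Finset.mem_insert, Finset.mem_singleton] at hx
    exact hx
  have hsum : ∀ f : n → K, ∑ x, f x = f p + f q := fun f => by
    rw [show (Finset.univ : Finset n) = {p, q} from huniv, Finset.sum_pair hpq]
  refine ⟨single p q 1 - single q p 1, single q p 1 - single p q 1, ?_, ?_, ?_⟩
  · rw [Matrix.sub_mul, Matrix.mul_sub, Matrix.mul_sub, single_mul_single_same, single_mul_single_of_ne (1:K) p q p hpq.symm 1,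
      single_mul_single_of_ne (1:K) q p q hpq 1, single_mul_single_same, mul_one, sub_zero, zero_sub, sub_neg_eq_add]
    ext i j
    rw [Matrix.add_apply, Matrix.one_apply]
    rcases hall i with rfl | rfl <;> rcases hall j with rfl | rfl <;> simp [hpq, hpq.symm]
  · rw [Matrix.sub_mul, Matrix.mul_sub, Matrix.mul_sub, single_mul_single_same, single_mul_single_of_ne (1:K) q p q hpq 1,
      single_mul_single_of_ne (1:K) p q p hpq.symm 1, single_mul_single_same, mul_one, sub_zero, zero_sub, sub_neg_eq_add]
    ext i j
    rw [Matrix.add_apply, Matrix.one_apply]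
    rcases hall i with rfl | rfl <;> rcases hall j with rfl | rfl <;> simp [hpq, hpq.symm]
  · intro X hX
    have htr : X p p + X q q = 0 := by rw [Matrix.trace, hsum] at hX; exact hX
    ext i j
    simp only [Matrix.neg_apply, Matrix.transpose_apply, Matrix.mul_apply, Matrix.sub_apply, hsum, single_apply]
    rcases hall i with rfl | rfl <;> rcases hall j with rfl | rfl <;> simp [hpq, hpq.symm] <;> linear_combination -htr

/-- **Jacobson's Theorem 5 — the tree's named fact `Jacobson1962_sl_automorphisms` DISCHARGED.** Every Lie algebra
automorphism of `𝔰𝔩ₙ(K)` (`K` algebraically closed of characteristic zero, `|n| ≥ 2`) is `X ↦ A⁻¹XA` for a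
nonsingular `A`, or — listed only for `|n| > 2`, since for `|n| = 2` the map `X ↦ −Xᵀ` is itself a conjugation —
`X ↦ −A⁻¹XᵀA`. Relies on: nothing unproved (parts I–V of this series).
[cite: Jacobson1962LieAlgebras, Ch. IX §5 Theorem 5 (p. 283)] -/
theorem Jacobson1962_sl_automorphisms_holds : Jacobson1962_sl_automorphisms := by
  intro K _ _ _ n _ _ hn φ
  classical
  obtain ⟨P, Q, hPQ, hQP, h⟩ := exists_conj_or_conj_transpose (by omega) φ
  have hQu : IsUnit Q := IsUnit.of_mul_eq_one P hQP
  have hQinv : Q⁻¹ = P := Matrix.inv_eq_right_inv hQP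
  rcases h with h | h
  · exact ⟨Q, hQu, Or.inl fun X => by rw [hQinv]; exact h X⟩
  · by_cases h3 : 2 < Fintype.card n
    · exact ⟨Q, hQu, Or.inr ⟨h3, fun X => by rw [hQinv]; exact h X⟩⟩
    · -- `|n| = 2`: `−Xᵀ = J' X J`, so `φ` is a conjugation after all
      have h2 : Fintype.card n = 2 := by omega
      obtain ⟨J, J', hJJ', hJ'J, hconj⟩ := exists_neg_transpose_eq_conj_of_card_two (K := K) h2
      refine ⟨J * Q, IsUnit.of_mul_eq_one (P * J') ?_, Or.inl fun X => ?_⟩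
      · rw [Matrix.mul_assoc, ← Matrix.mul_assoc Q, hQP, Matrix.one_mul, hJJ']
      · have hinv : (J * Q)⁻¹ = P * J' :=
          Matrix.inv_eq_right_inv (by rw [Matrix.mul_assoc, ← Matrix.mul_assoc Q, hQP, Matrix.one_mul, hJJ'])
        rw [hinv, h X, show P * J' * (X : Matrix n n K) * (J * Q) = P * (J' * X * J) * Q by
              simp only [Matrix.mul_assoc], ← hconj _ X.2, Matrix.mul_neg, Matrix.neg_mul]

end Holds

end Literature.Algebra.Lie.SpecialLinearAutomorphisms
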